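import Summits.Ventures.LatticeQCDFlow.Scoring.TorusLocalLimit2D
import Summits.Ventures.LatticeQCDFlow.Scoring.ThermodynamicLimitTools
import HarnessLib

/-!
# The exact non-abelian area law in two dimensions, V-i: the thermodynamic limit of the torus Wilson loop; `⟨W_{R×T}⟩_{(ℤ/L)²,β} → P_N(β)^{RT}` for `U(N)` and `SU(N)`

HONEST FRAMING: exact (Metropolis-corrected) sampling algorithms for lattice gauge theory;
figures of merit are autocorrelation/cost numbers at stated couplings and volumes; no
continuum-physics claim.

Venture `LatticeQCDFlow` (cell pub-lqcd), sub-topic `Scoring`; FANOUT row 5 (`s0-sun-a`), GEN-19.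
NEW WORK of the cell (placement rule).  Two-dimensional lattice Yang–Mills on the torus `(ℤ/L)²` with
theory-2's Wilson measure, every compact second-countable gauge group, continuous representation `ρ`, any
real `β`; `m = ∫ e^{−β(N − Re tr ρ)} dHaar`, `B = sup |Re tr ρ|`:

* §4 **`abs_wilsonExpectation_loop_sub_le`** — for a scalar one-plaquette matrix `∫ ρ(g) e^{−β(N−Re tr ρ(g))} dg = c·1`
  (every irreducible `ρ`; the defining representations of `U(N)`, `SU(N)`), every `L ≥ 2`, corner `x`,
  `1 ≤ R, T`, `R + 1 ≤ L`, `T + 1 ≤ L`: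
  `|⟨W_{R×T}⟩_{L,β} − Re((c/m)^{RT})| ≤ (2B/N) e^{2|β|(N+B)} (1 − e^{−|β|(N+B)}/m)^{L² − RT − 1}`
  (V-h applied to the loop, whose free-boundary value is part II/§5's `Re((c/m)^{RT})`);
  **`tendsto_wilsonExpectation_loop`: THE THERMODYNAMIC LIMIT OF
  THE TORUS WILSON LOOP EXISTS AND EQUALS THE FREE-BOUNDARY VALUE**, `⟨W_{R×T}⟩_{(ℤ/(L+1))²,β} → Re((c/m)^{RT})`
  as `L → ∞`, at any (moving) position;
* §5 **`unitary_tendsto_wilsonExpectation_loop`**, **`specialUnitary_tendsto_wilsonExpectation_loop`** — `U(N)`,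
  `SU(N)`, every `N ≥ 1`, every real `β`: `⟨W_{R×T}⟩_{(ℤ/(L+1))²,β} → P_N(β)^{RT}`, `P_N(β)` the one-plaquette
  plaquette (`= N⁻¹(log det[I_{|i−j|}])′(β)` resp. `N⁻¹(log Σ_q det[I_{|q+i−j|}])′(β)` in closed Bessel form,
  row 5 GEN-17): THE EXACT STRING TENSION OF TWO-DIMENSIONAL `U(N)` / `SU(N)` LATTICE YANG–MILLS IN INFINITE
  VOLUME IS `−log P_N(β)` (`β > 0`; every Creutz ratio of the limit equals it).

Published forms: Gross–Witten, Phys. Rev. D 21 (1980) 446, §II (infinite plane, axial gauge); for the torus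
cf. Migdal, Sov. Phys. JETP 42 (1975) 413 and Rusakov, Mod. Phys. Lett. A5 (1990) 693 (character expansions).
Here: no characters, no gauge fixing.  No `def`, nothing cited as a fact, 0 sorry.
-/

noncomputable section

open MeasureTheory Function Finset Filter Topology
open Literature.MathematicalPhysics.QuantumFieldTheory
open Literature.MathematicalPhysics.QuantumLattice
open Summit.Ventures.LatticeQCDFlow.Theory2.Lattice
open Summit.Ventures.LatticeQCDFlow.Theory2.Lattice.TwoDim

namespace Summit.Ventures.LatticeQCDFlow.Scoring

variable {L : ℕ} [NeZero L] {G : Type*} [Group G] [TopologicalSpace G] [IsTopologicalGroup G]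
  [CompactSpace G] [SecondCountableTopology G] [MeasurableSpace G] [BorelSpace G] {N : ℕ}
  (ρ : G →* Matrix (Fin N) (Fin N) ℂ)

/-! ## §4. Wilson loops: the thermodynamic limit on the torus -/

/-- **EXPONENTIALLY SMALL FINITE-SIZE CORRECTIONS FOR THE TORUS WILSON LOOP.**  For a scalar one-plaquette
matrix `∫ ρ(g) e^{−β(N − Re tr ρ(g))} dg = c·1` and every `L ≥ 2`, corner `x`, `1 ≤ R, T`, `R + 1 ≤ L`,
`T + 1 ≤ L`: `|⟨W_{R×T}⟩_{L,β} − Re((c/m)^{RT})| ≤ (2B/N) e^{2|β|(N+B)} (1 − e^{−|β|(N+B)}/m)^{L² − RT − 1}`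
(`m = ∫ e^{−β(N − Re tr ρ)} dHaar`; `Re((c/m)^{RT})` is the free-boundary value of part II/§5). -/
theorem abs_wilsonExpectation_loop_sub_le [NeZero N] (hρ : Continuous ρ) (β : ℝ) {B : ℝ}
    (hB : ∀ g : G, |(ρ g).trace.re| ≤ B) {c : ℂ}
    (hM : (Matrix.of fun k l : Fin N => ∫ g, ρ g k l *
      (Real.exp (-(β * ((N : ℝ) - (ρ g).trace.re))) : ℂ) ∂(haarProbability G)) =
        c • (1 : Matrix (Fin N) (Fin N) ℂ))
    (hL : 2 ≤ L) (x : Site 2 L) {R T : ℕ} (hR1 : 1 ≤ R) (hT1 : 1 ≤ T) (hR : R + 1 ≤ L) (hT : T + 1 ≤ L) :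
    |wilsonExpectation ρ β (wilsonLoop ρ x 0 1 R T) -
        ((c / ∫ g, Real.exp (-(β * ((N : ℝ) - (ρ g).trace.re))) ∂(haarProbability G)) ^ (R * T)).re| ≤
      2 * (B / N) * Real.exp (2 * (|β| * (N + B))) *
        (1 - Real.exp (-(|β| * (N + B))) /
          ∫ g, Real.exp (-(β * ((N : ℝ) - (ρ g).trace.re))) ∂(haarProbability G)) ^ (L ^ 2 - R * T - 1) := by
  have hw : Continuous fun g : G => Real.exp (-(β * ((N : ℝ) - (ρ g).trace.re))) := by
    have := Complex.continuous_re.comp hρ.matrix_trace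
    fun_prop
  have hwc : ∀ k g : G, Real.exp (-(β * ((N : ℝ) - (ρ (k * g * k⁻¹)).trace.re))) =
      Real.exp (-(β * ((N : ℝ) - (ρ g).trace.re))) := fun k g => by
    rw [map_mul, map_mul, Matrix.trace_mul_cycle, ← map_mul, inv_mul_cancel, map_one, one_mul]
  have hx : (![x 0, x 1] : Site 2 L) = x := site_two_eta x
  -- the loop is a local observable of its region, bounded by `B/N`
  have hWc : Continuous (wilsonLoop ρ x 0 1 R T) := by
    unfold wilsonLoop
    exact continuous_const.mul (Complex.continuous_re.comp
      ((hρ.comp (continuous_config_rectangleHolonomy x 0 1 R T)).matrix_trace))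
  have hWb : ∀ U : GaugeConfig 2 L G, |wilsonLoop ρ x 0 1 R T U| ≤ B / N := fun U => by
    unfold wilsonLoop
    rw [abs_mul, abs_inv, Nat.abs_cast, div_eq_inv_mul]
    exact mul_le_mul_of_nonneg_left (hB _) (by positivity)
  have hWe : ∀ (e : Edge 2 L) (U : GaugeConfig 2 L G) (g : G),
      (∀ p ∈ (range R ×ˢ range T).image (fun q : ℕ × ℕ => (![x 0 + q.1, x 1 + q.2] : Site 2 L)),
        ((p, 0) : Edge 2 L) ≠ e ∧ ((Site.shift p 0, 1) : Edge 2 L) ≠ e ∧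
          ((Site.shift p 1, 0) : Edge 2 L) ≠ e ∧ ((p, 1) : Edge 2 L) ≠ e) →
      wilsonLoop ρ x 0 1 R T (update U e g) = wilsonLoop ρ x 0 1 R T U := fun e U g he => by
    unfold wilsonLoop
    rw [← hx, rectangleHolonomy_update_eq_of_forall_rect (x 0) (x 1) hR1 hT1 g he]
  have h := abs_wilsonExpectation_local_sub_le ρ hρ β hB hL (x 0) (x 1) hR hT
    (Φ := wilsonLoop ρ x 0 1 R T) hWc hWe hWb
  -- the free-boundary value
  have hopen : (∫ U, wilsonLoop ρ ![x 0, x 1] 0 1 R T U *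
        ∏ p ∈ (range R ×ˢ range T).image (fun q : ℕ × ℕ => (![x 0 + q.1, x 1 + q.2] : Site 2 L)),
          Real.exp (-(β * ((N : ℝ) - (ρ (plaquetteHolonomy U p 0 1)).trace.re)))
          ∂(Measure.pi fun _ : Edge 2 L => haarProbability G)) /
        (∫ U, ∏ p ∈ (range R ×ˢ range T).image (fun q : ℕ × ℕ => (![x 0 + q.1, x 1 + q.2] : Site 2 L)),
          Real.exp (-(β * ((N : ℝ) - (ρ (plaquetteHolonomy U p 0 1)).trace.re)))
          ∂(Measure.pi fun _ : Edge 2 L => haarProbability G)) =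
      ((c / ∫ g, Real.exp (-(β * ((N : ℝ) - (ρ g).trace.re))) ∂(haarProbability G)) ^ (R * T)).re := by
    rw [integral_wilsonLoop_mul_prod_weight_of_scalar ρ hρ hw hwc hM (x 0) (x 1) hR hT,
      integral_prod_weight_rect hw hwc (x 0) (x 1) hR hT, div_pow, ← Complex.ofReal_pow,
      Complex.div_ofReal_re]
  rw [hx] at hopen
  rw [hopen] at h
  calc _ ≤ 2 * (B / N) * Real.exp (2 * (|β| * (N + B))) * _ := h
    _ = _ := by ring

/-- **THE THERMODYNAMIC LIMIT OF THE TORUS WILSON LOOP EXISTS AND EQUALS THE FREE-BOUNDARY VALUE**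
(two-dimensional lattice Yang–Mills, every compact second-countable gauge group, every continuous
representation `ρ` with scalar one-plaquette matrix `c·1` — every irreducible `ρ`, the defining
representations of `U(N)` and `SU(N)` — every real `β`): for every `R, T ≥ 1` and any corners `x_L`,
`⟨W_{R×T}⟩_{(ℤ/(L+1))²,β} → Re((c/m)^{RT})` as `L → ∞` (`m = ∫ e^{−β(N − Re tr ρ)} dHaar`). -/
theorem tendsto_wilsonExpectation_loop [NeZero N] (hρ : Continuous ρ) (β : ℝ) {c : ℂ}
    (hM : (Matrix.of fun k l : Fin N => ∫ g, ρ g k l *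
      (Real.exp (-(β * ((N : ℝ) - (ρ g).trace.re))) : ℂ) ∂(haarProbability G)) =
        c • (1 : Matrix (Fin N) (Fin N) ℂ))
    {R T : ℕ} (hR1 : 1 ≤ R) (hT1 : 1 ≤ T) (x : ∀ L : ℕ, Site 2 (L + 1)) :
    Tendsto (fun L : ℕ => wilsonExpectation (L := L + 1) ρ β (wilsonLoop ρ (x L) 0 1 R T)) atTop
      (𝓝 ((c / ∫ g, Real.exp (-(β * ((N : ℝ) - (ρ g).trace.re))) ∂(haarProbability G)) ^ (R * T)).re) := by
  obtain ⟨B, hB0, hB⟩ := exists_bound_trace_re_nonneg ρ hρ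
  have hw : Continuous fun g : G => Real.exp (-(β * ((N : ℝ) - (ρ g).trace.re))) := by
    have := Complex.continuous_re.comp hρ.matrix_trace
    fun_prop
  have hbound : ∀ g : G, |β * ((N : ℝ) - (ρ g).trace.re)| ≤ |β| * (N + B) := fun g => by
    rw [abs_mul]
    refine mul_le_mul_of_nonneg_left ?_ (abs_nonneg β)
    have h1 := hB g
    have h2 : |((N : ℝ) - (ρ g).trace.re)| ≤ |(N : ℝ)| + |(ρ g).trace.re| := abs_sub _ _
    rw [Nat.abs_cast] at h2
    linarith
  have hwlo : ∀ g : G, Real.exp (-(|β| * (N + B))) ≤ Real.exp (-(β * ((N : ℝ) - (ρ g).trace.re))) :=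
    fun g => Real.exp_le_exp.mpr (by linarith [(abs_le.mp (hbound g)).2])
  have hm_lo : Real.exp (-(|β| * (N + B))) ≤
      ∫ g, Real.exp (-(β * ((N : ℝ) - (ρ g).trace.re))) ∂(haarProbability G) := by
    have h : ∫ _g : G, Real.exp (-(|β| * (N + B))) ∂(haarProbability G) ≤
        ∫ g, Real.exp (-(β * ((N : ℝ) - (ρ g).trace.re))) ∂(haarProbability G) :=
      integral_mono (integrable_const _) (integrable_haarProbability_of_continuous hw) hwlo
    simpa using h
  have hm_pos : 0 < ∫ g, Real.exp (-(β * ((N : ℝ) - (ρ g).trace.re))) ∂(haarProbability G) :=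
    lt_of_lt_of_le (Real.exp_pos _) hm_lo
  have hq0 : 0 ≤ 1 - Real.exp (-(|β| * (N + B))) /
      ∫ g, Real.exp (-(β * ((N : ℝ) - (ρ g).trace.re))) ∂(haarProbability G) := by
    rw [sub_nonneg]
    exact (div_le_one hm_pos).mpr hm_lo
  have hq1 : 1 - Real.exp (-(|β| * (N + B))) /
      ∫ g, Real.exp (-(β * ((N : ℝ) - (ρ g).trace.re))) ∂(haarProbability G) < 1 := by
    have : 0 < Real.exp (-(|β| * (N + B))) /
        ∫ g, Real.exp (-(β * ((N : ℝ) - (ρ g).trace.re))) ∂(haarProbability G) :=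
      div_pos (Real.exp_pos _) hm_pos
    linarith
  exact tendsto_of_abs_sub_le_mul_pow (L₀ := R + T) hq0 hq1 fun L hL =>
    abs_wilsonExpectation_loop_sub_le ρ hρ β hB hM (by omega) (x L) hR1 hT1 (by omega) (by omega)

/-! ## §5. `U(N)` and `SU(N)`: the torus Wilson loop tends to `P_N(β)^{RT}` -/

/-- **THE THERMODYNAMIC LIMIT OF THE WILSON LOOPS OF TWO-DIMENSIONAL `U(N)` LATTICE YANG–MILLS, EVERY `N ≥ 1`,
EVERY REAL `β`**: for `R, T ≥ 1` and any corners `x_L`,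
`⟨W_{R×T}⟩_{(ℤ/(L+1))²,β} → P_N(β)^{RT}` as `L → ∞`, `P_N(β) = ∫ (Re tr u/N) e^{−β(N−Re tr u)} du / ∫ e^{−β(N−Re tr u)} du`
the one-plaquette plaquette (`= N⁻¹(log det[I_{|i−j|}])′(β)`, row 5 GEN-17; `N = 1`: `I₁(β)/I₀(β)`): the
infinite-volume string tension of 2-d `U(N)` lattice gauge theory is exactly `−log P_N(β)` (`β > 0`). -/
theorem unitary_tendsto_wilsonExpectation_loop (N : ℕ) [NeZero N] (β : ℝ) {R T : ℕ} (hR1 : 1 ≤ R)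
    (hT1 : 1 ≤ T) (x : ∀ L : ℕ, Site 2 (L + 1)) :
    Tendsto (fun L : ℕ => wilsonExpectation (L := L + 1) (unitaryFundamentalRep (Fin N) ℂ) β
        (wilsonLoop (unitaryFundamentalRep (Fin N) ℂ) (x L) 0 1 R T)) atTop
      (𝓝 (((∫ u, ((u : Matrix.unitaryGroup (Fin N) ℂ) : Matrix (Fin N) (Fin N) ℂ).trace.re / N *
              Real.exp (-(β * ((N : ℝ) -
                ((u : Matrix.unitaryGroup (Fin N) ℂ) : Matrix (Fin N) (Fin N) ℂ).trace.re)))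
              ∂(haarProbability (Matrix.unitaryGroup (Fin N) ℂ))) /
            (∫ u, Real.exp (-(β * ((N : ℝ) -
                ((u : Matrix.unitaryGroup (Fin N) ℂ) : Matrix (Fin N) (Fin N) ℂ).trace.re)))
              ∂(haarProbability (Matrix.unitaryGroup (Fin N) ℂ)))) ^ (R * T))) := by
  have hF : Continuous fun x : ℝ => Real.exp (-(β * ((N : ℝ) - x))) := by fun_prop
  have hM : (Matrix.of fun k l : Fin N => ∫ u, (unitaryFundamentalRep (Fin N) ℂ) u k l *
      (Real.exp (-(β * ((N : ℝ) - ((unitaryFundamentalRep (Fin N) ℂ) u).trace.re))) : ℂ)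
        ∂(haarProbability (Matrix.unitaryGroup (Fin N) ℂ))) =
      (((N : ℝ)⁻¹ * ∫ u, ((u : Matrix.unitaryGroup (Fin N) ℂ) : Matrix (Fin N) (Fin N) ℂ).trace.re *
          Real.exp (-(β * ((N : ℝ) - ((u : Matrix.unitaryGroup (Fin N) ℂ) : Matrix (Fin N) (Fin N) ℂ).trace.re)))
          ∂(haarProbability (Matrix.unitaryGroup (Fin N) ℂ)) : ℝ) : ℂ) • (1 : Matrix (Fin N) (Fin N) ℂ) := by
    simp only [unitaryFundamentalRep_apply]
    exact unitary_integralMatrix_eq_smul_one N hF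
  have h := tendsto_wilsonExpectation_loop (unitaryFundamentalRep (Fin N) ℂ)
    (continuous_unitaryFundamentalRep (Fin N) ℂ) β hM hR1 hT1 x
  simp only [unitaryFundamentalRep_apply] at h
  rw [← Complex.ofReal_div, ← Complex.ofReal_pow, Complex.ofReal_re] at h
  have hval : (N : ℝ)⁻¹ * ∫ u, ((u : Matrix.unitaryGroup (Fin N) ℂ) : Matrix (Fin N) (Fin N) ℂ).trace.re *
        Real.exp (-(β * ((N : ℝ) - ((u : Matrix.unitaryGroup (Fin N) ℂ) : Matrix (Fin N) (Fin N) ℂ).trace.re)))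
        ∂(haarProbability (Matrix.unitaryGroup (Fin N) ℂ)) =
      ∫ u, ((u : Matrix.unitaryGroup (Fin N) ℂ) : Matrix (Fin N) (Fin N) ℂ).trace.re / N *
        Real.exp (-(β * ((N : ℝ) - ((u : Matrix.unitaryGroup (Fin N) ℂ) : Matrix (Fin N) (Fin N) ℂ).trace.re)))
        ∂(haarProbability (Matrix.unitaryGroup (Fin N) ℂ)) := by
    rw [← integral_const_mul]
    congr 1
    funext u
    ring
  rw [hval] at h
  exact h

/-- **THE THERMODYNAMIC LIMIT OF THE WILSON LOOPS OF TWO-DIMENSIONAL `SU(N)` LATTICE YANG–MILLS, EVERY `N ≥ 1`,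
EVERY REAL `β`**: for `R, T ≥ 1` and any corners `x_L`, `⟨W_{R×T}⟩_{(ℤ/(L+1))²,β} → P_N(β)^{RT}` as `L → ∞`,
`P_N(β)` the `SU(N)` one-plaquette plaquette (`= N⁻¹(log Σ_q det[I_{|q+i−j|}])′(β)`, row 5 GEN-17; `N = 2`:
`I₂(2β)/I₁(2β)`): the infinite-volume string tension of 2-d `SU(N)` lattice gauge theory is exactly
`−log P_N(β)` (`N ≥ 2`, `β > 0`). -/
theorem specialUnitary_tendsto_wilsonExpectation_loop (N : ℕ) [NeZero N] (β : ℝ) {R T : ℕ}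
    (hR1 : 1 ≤ R) (hT1 : 1 ≤ T) (x : ∀ L : ℕ, Site 2 (L + 1)) :
    Tendsto (fun L : ℕ => wilsonExpectation (L := L + 1) (fundamentalRep (Fin N)) β
        (wilsonLoop (fundamentalRep (Fin N)) (x L) 0 1 R T)) atTop
      (𝓝 (((∫ u, ((u : Matrix.specialUnitaryGroup (Fin N) ℂ) : Matrix (Fin N) (Fin N) ℂ).trace.re / N *
              Real.exp (-(β * ((N : ℝ) -
                ((u : Matrix.specialUnitaryGroup (Fin N) ℂ) : Matrix (Fin N) (Fin N) ℂ).trace.re)))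
              ∂(haarProbability (Matrix.specialUnitaryGroup (Fin N) ℂ))) /
            (∫ u, Real.exp (-(β * ((N : ℝ) -
                ((u : Matrix.specialUnitaryGroup (Fin N) ℂ) : Matrix (Fin N) (Fin N) ℂ).trace.re)))
              ∂(haarProbability (Matrix.specialUnitaryGroup (Fin N) ℂ)))) ^ (R * T))) := by
  have hF : Continuous fun x : ℝ => Real.exp (-(β * ((N : ℝ) - x))) := by fun_prop
  have hM : (Matrix.of fun k l : Fin N => ∫ u, (fundamentalRep (Fin N)) u k l *
      (Real.exp (-(β * ((N : ℝ) - ((fundamentalRep (Fin N)) u).trace.re))) : ℂ)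
        ∂(haarProbability (Matrix.specialUnitaryGroup (Fin N) ℂ))) =
      (((N : ℝ)⁻¹ * ∫ u, ((u : Matrix.specialUnitaryGroup (Fin N) ℂ) : Matrix (Fin N) (Fin N) ℂ).trace.re *
          Real.exp (-(β * ((N : ℝ) -
            ((u : Matrix.specialUnitaryGroup (Fin N) ℂ) : Matrix (Fin N) (Fin N) ℂ).trace.re)))
          ∂(haarProbability (Matrix.specialUnitaryGroup (Fin N) ℂ)) : ℝ) : ℂ) •
        (1 : Matrix (Fin N) (Fin N) ℂ) := by
    simp only [fundamentalRep_apply]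
    exact specialUnitary_integralMatrix_eq_smul_one N hF
  have h := tendsto_wilsonExpectation_loop (fundamentalRep (Fin N)) (continuous_fundamentalRep (Fin N)) β
    hM hR1 hT1 x
  simp only [fundamentalRep_apply] at h
  rw [← Complex.ofReal_div, ← Complex.ofReal_pow, Complex.ofReal_re] at h
  have hval : (N : ℝ)⁻¹ * ∫ u, ((u : Matrix.specialUnitaryGroup (Fin N) ℂ) : Matrix (Fin N) (Fin N) ℂ).trace.re *
        Real.exp (-(β * ((N : ℝ) - ((u : Matrix.specialUnitaryGroup (Fin N) ℂ) : Matrix (Fin N) (Fin N) ℂ).trace.re)))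
        ∂(haarProbability (Matrix.specialUnitaryGroup (Fin N) ℂ)) =
      ∫ u, ((u : Matrix.specialUnitaryGroup (Fin N) ℂ) : Matrix (Fin N) (Fin N) ℂ).trace.re / N *
        Real.exp (-(β * ((N : ℝ) - ((u : Matrix.specialUnitaryGroup (Fin N) ℂ) : Matrix (Fin N) (Fin N) ℂ).trace.re)))
        ∂(haarProbability (Matrix.specialUnitaryGroup (Fin N) ℂ)) := by
    rw [← integral_const_mul]
    congr 1
    funext u
    ring
  rw [hval] at h
  exact h

end Summit.Ventures.LatticeQCDFlow.Scoring
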